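import Mathlib.Algebra.Polynomial.Taylor
import Mathlib.Algebra.Polynomial.Inductions
import Mathlib.Algebra.MvPolynomial.CommRing
import Mathlib.RingTheory.MvPolynomial.Basic
import Mathlib.Tactic.LinearCombination
import HarnessLib

/-!
# Temkin's decompletion lemma, algebraic proof — polynomial algebra of the polydisc chart

Topic: `Literature/AlgebraicGeometry/Resolution`. M. Temkin, *Inseparable local uniformization*,
J. Algebra 373 (2013) 65–119 = arXiv:0804.1554v3, Lemma 3.3.2 (tree: `Temkin2013_Lemma332_nft`).

Chart-independent polynomial book-keeping for the `m°`-polydisc chart `E` of the algebraic proof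
of the decompletion lemma. Over an arbitrary commutative ring `R` (in the application `R = m°`)
with `S = R[X₁, …, X_n]`, for a polynomial `F ∈ S[W]` we form the zoomed polynomial
`F(π^{j} X, w₀ + c₀ π^r W)` and divide it EXACTLY by the constants dictated by Newton's method:

* `zoomX c : S →ₐ[R] S`, `Xᵢ ↦ c Xᵢ`, and `exists_zoomX_eq`: `Q(cX) = Q(0) + c·Q₁` — PROVED;
* `comp_C_mul_X_eq`: `q(μW) = q₀ + q₁ μ W + μ² W² · (q − q₀ − q₁W)/W² (μW)` — PROVED;
* `zpoly`, `ztaylor` (Taylor expansion of the zoomed polynomial at `W = w₀`) and the values of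
  its first two coefficients — PROVED;
* `Ftilde` — the Newton-normalized chart equation `F̃ = F(π^j X, w₀ + c₀π^r W)/(c₀² π^r)` as an
  HONEST polynomial over `S`, with `Ftilde_spec : C(c₀²π^r) · F̃ = F(π^j X, w₀ + c₀π^r W)` given
  `c₀ ι₀ = π^{N₀}`, `F(0, w₀) = 0`, `F_W(0, w₀) = c₀`, `j ≥ r + 2N₀` — PROVED; its constant and
  linear coefficients (`Ftilde_coeff_zero/one`) — PROVED;
* `Ztilde` — for `Φ ∈ S[W]`, `κ, z₀ ∈ R` with `Φ(0, w₀)·κ = π^b z₀`: the honest polynomial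
  `Ž = Φ(π^j X, w₀ + c₀π^r W)·κ/π^b` with `Ztilde_spec : C(π^b)·Ž = C κ · Φ(π^j X, w₀ + c₀π^rW)`
  (`j, r ≥ b`) and `Ž ≡ z₀` modulo `(π, W)` (`Ztilde_coeff_zero`) — PROVED. (Used for the
  normalized localized polynomial `Ğ` (`κ = π^{N_g}/g₀`, `z₀ = 1`) and for the built-in units
  `Š, Ť, …` representing the images of `s, t, …` in the chart.)

All declarations live in the sub-namespace `Polydisc` (chart-local short names `ρ₀, ρ₁, σ₀, …`).
All statements are [folklore] (Newton/Hensel normalization); no named facts.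

## Sources

* M. Temkin, arXiv:0804.1554v3, proof of Lemma 3.3.2 (pp. 45–46): the `m̂°`-polydisc `𝔛′_η ∩ Y`.
-/

noncomputable section

open Polynomial

namespace Literature.AlgebraicGeometry.Resolution

namespace Polydisc

section ZoomAlgebra

variable {R : Type*} [CommRing R] {n : ℕ}

/-! ### Zooming the polydisc variables -/

/-- `zoomX c : Xᵢ ↦ c·Xᵢ` on `R[X₁, …, X_n]`. [folklore] -/
def zoomX (c : R) : MvPolynomial (Fin n) R →ₐ[R] MvPolynomial (Fin n) R :=
  MvPolynomial.aeval fun i => MvPolynomial.C c * MvPolynomial.X i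

/-- `zoomX` fixes constants. [folklore] -/
@[simp] theorem zoomX_C (c a : R) :
    zoomX (n := n) c (MvPolynomial.C a) = MvPolynomial.C a := by
  simp [zoomX]

/-- `zoomX c Xᵢ = c Xᵢ`. [folklore] -/
@[simp] theorem zoomX_X (c : R) (i : Fin n) :
    zoomX c (MvPolynomial.X i) = MvPolynomial.C c * MvPolynomial.X i := by
  simp [zoomX]

/-- **Zoom divisibility**: `Q(cX) = Q(0) + c·Q₁`. [folklore] -/
theorem exists_zoomX_eq (c : R) (Q : MvPolynomial (Fin n) R) :
    ∃ Q₁ : MvPolynomial (Fin n) R,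
      zoomX c Q = MvPolynomial.C (MvPolynomial.constantCoeff Q) + MvPolynomial.C c * Q₁ := by
  induction Q using MvPolynomial.induction_on with
  | C a => exact ⟨0, by simp⟩
  | add p q hp hq =>
    obtain ⟨p₁, hp₁⟩ := hp
    obtain ⟨q₁, hq₁⟩ := hq
    exact ⟨p₁ + q₁, by rw [map_add, hp₁, hq₁, map_add, map_add]; ring⟩
  | mul_X p i hp =>
    obtain ⟨p₁, hp₁⟩ := hp
    refine ⟨zoomX c p * MvPolynomial.X i, ?_⟩
    rw [map_mul, zoomX_X, map_mul, MvPolynomial.constantCoeff_X, mul_zero, map_zero, zero_add]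
    ring

/-- `Q(cX)(0) = Q(0)`. [folklore] -/
theorem constantCoeff_zoomX (c : R) (Q : MvPolynomial (Fin n) R) :
    MvPolynomial.constantCoeff (zoomX c Q) = MvPolynomial.constantCoeff Q := by
  induction Q using MvPolynomial.induction_on with
  | C a => simp
  | add p q hp hq => rw [map_add, map_add, hp, hq, map_add]
  | mul_X p i hp => simp [hp]

/-! ### Scaling the Newton variable -/

/-- `q(μW) = q₀ + q₁ μ W + μ² W² · ((q − q₀ − q₁ W)/W²)(μW)`. [folklore] -/
theorem comp_C_mul_X_eq {L : Type*} [CommRing L] (q : L[X]) (μ : L) :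
    q.comp (C μ * X) = C (q.coeff 0) + C (q.coeff 1 * μ) * X +
      C μ ^ 2 * X ^ 2 * (q.divX.divX).comp (C μ * X) := by
  conv_lhs => rw [← X_mul_divX_add q, ← X_mul_divX_add q.divX]
  simp only [add_comp, mul_comp, X_comp, C_comp, coeff_divX, zero_add, map_mul]
  ring

/-! ### The zoomed polynomial and its Taylor expansion at `w₀` -/

variable (c : R) (F : (MvPolynomial (Fin n) R)[X]) (w₀ : R)

/-- `F(cX, W)`: zoom the polydisc variables in the coefficients. [folklore] -/
def zpoly : (MvPolynomial (Fin n) R)[X] := F.map (zoomX (n := n) c).toRingHom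

/-- The Taylor expansion of `F(cX, W)` at `W = w₀`. [folklore] -/
def ztaylor : (MvPolynomial (Fin n) R)[X] := taylor (MvPolynomial.C w₀) (zpoly c F)

/-- `F(cX, w₀ + W′) = (ztaylor)(W′)`: `zpoly ∘ (w₀ + μW) = ztaylor ∘ (μW)`. [folklore] -/
theorem zpoly_comp (μ : MvPolynomial (Fin n) R) :
    (zpoly c F).comp (C (MvPolynomial.C w₀) + C μ * X) = (ztaylor c F w₀).comp (C μ * X) := by
  rw [ztaylor, taylor_apply, comp_assoc, add_comp, X_comp, C_comp, add_comm]

/-- `(ztaylor)₀ = F(cX, w₀) = zoomX c (F(X, w₀))`. [folklore] -/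
theorem ztaylor_coeff_zero :
    (ztaylor c F w₀).coeff 0 = zoomX c (F.eval (MvPolynomial.C w₀)) := by
  rw [ztaylor, taylor_coeff_zero, zpoly, eval_map]
  change _ = (zoomX (n := n) c).toRingHom (F.eval (MvPolynomial.C w₀))
  rw [← eval₂_at_apply]
  congr 1
  exact (zoomX_C c w₀).symm

/-- `(ztaylor)₁ = F_W(cX, w₀) = zoomX c (F_W(X, w₀))`. [folklore] -/
theorem ztaylor_coeff_one :
    (ztaylor c F w₀).coeff 1 = zoomX c ((derivative F).eval (MvPolynomial.C w₀)) := by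
  rw [ztaylor, taylor_coeff_one, zpoly, derivative_map, eval_map]
  change _ = (zoomX (n := n) c).toRingHom ((derivative F).eval (MvPolynomial.C w₀))
  rw [← eval₂_at_apply]
  congr 1
  exact (zoomX_C c w₀).symm

/-! ### The Newton-normalized chart equation `F̃` -/

section Ftilde

variable (π c₀ ι₀ : R) (N₀ r jz : ℕ)

/-- `ρ₀` with `F(π^j X, w₀) = F(0, w₀) + π^j ρ₀`. [folklore] -/
def ρ₀ : MvPolynomial (Fin n) R :=
  (exists_zoomX_eq (π ^ jz) (F.eval (MvPolynomial.C w₀))).choose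

/-- Defining property of `ρ₀`. [folklore] -/
theorem ρ₀_spec : zoomX (π ^ jz) (F.eval (MvPolynomial.C w₀)) =
    MvPolynomial.C (MvPolynomial.constantCoeff (F.eval (MvPolynomial.C w₀))) +
      MvPolynomial.C (π ^ jz) * ρ₀ F w₀ π jz :=
  (exists_zoomX_eq (π ^ jz) (F.eval (MvPolynomial.C w₀))).choose_spec

/-- `ρ₁` with `F_W(π^j X, w₀) = F_W(0, w₀) + π^j ρ₁`. [folklore] -/
def ρ₁ : MvPolynomial (Fin n) R :=
  (exists_zoomX_eq (π ^ jz) ((derivative F).eval (MvPolynomial.C w₀))).choose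

/-- Defining property of `ρ₁`. [folklore] -/
theorem ρ₁_spec : zoomX (π ^ jz) ((derivative F).eval (MvPolynomial.C w₀)) =
    MvPolynomial.C (MvPolynomial.constantCoeff ((derivative F).eval (MvPolynomial.C w₀))) +
      MvPolynomial.C (π ^ jz) * ρ₁ F w₀ π jz :=
  (exists_zoomX_eq (π ^ jz) ((derivative F).eval (MvPolynomial.C w₀))).choose_spec

/-- `π^j · ρ₀(0) = 0` (evaluate the defining property of `ρ₀` at `X = 0`). [folklore] -/
theorem pow_mul_constantCoeff_ρ₀ :
    π ^ jz * MvPolynomial.constantCoeff (ρ₀ F w₀ π jz) = 0 := by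
  have h := congrArg MvPolynomial.constantCoeff (ρ₀_spec F w₀ π jz)
  rw [constantCoeff_zoomX, map_add, map_mul, MvPolynomial.constantCoeff_C,
    MvPolynomial.constantCoeff_C] at h
  exact (add_eq_left.mp h.symm)

/-- `π^j · ρ₁(0) = 0`. [folklore] -/
theorem pow_mul_constantCoeff_ρ₁ :
    π ^ jz * MvPolynomial.constantCoeff (ρ₁ F w₀ π jz) = 0 := by
  have h := congrArg MvPolynomial.constantCoeff (ρ₁_spec F w₀ π jz)
  rw [constantCoeff_zoomX, map_add, map_mul, MvPolynomial.constantCoeff_C,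
    MvPolynomial.constantCoeff_C] at h
  exact (add_eq_left.mp h.symm)

/-- **The Newton-normalized chart equation**
`F̃(X, W) = F(π^j X, w₀ + c₀π^r W)/(c₀² π^r)
         = π^{j−r−2N₀} ρ₀ ι₀² + (1 + π^{j−N₀} ι₀ ρ₁) W + π^r W² · (…)`,
an honest polynomial over `R[X₁, …, X_n]` (here `ι₀ = π^{N₀}/c₀`). [folklore] -/
def Ftilde : (MvPolynomial (Fin n) R)[X] :=
  C (MvPolynomial.C (π ^ (jz - r - 2 * N₀) * ι₀ ^ 2) * ρ₀ F w₀ π jz) +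
    C (1 + MvPolynomial.C (π ^ (jz - N₀) * ι₀) * ρ₁ F w₀ π jz) * X +
    C (MvPolynomial.C (π ^ r)) * X ^ 2 *
      ((ztaylor (π ^ jz) F w₀).divX.divX).comp (C (MvPolynomial.C (c₀ * π ^ r)) * X)

/-- `F̃₀ = π^{j−r−2N₀} ι₀² ρ₀`. [folklore] -/
theorem Ftilde_coeff_zero : (Ftilde F w₀ π c₀ ι₀ N₀ r jz).coeff 0 =
    MvPolynomial.C (π ^ (jz - r - 2 * N₀) * ι₀ ^ 2) * ρ₀ F w₀ π jz := by
  rw [Ftilde, coeff_add, coeff_add, coeff_C_zero, coeff_C_mul, coeff_X_zero, mul_zero, add_zero,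
    mul_assoc, coeff_C_mul, coeff_X_pow_mul', if_neg (by omega), mul_zero, add_zero]

/-- `F̃₁ = 1 + π^{j−N₀} ι₀ ρ₁`. [folklore] -/
theorem Ftilde_coeff_one : (Ftilde F w₀ π c₀ ι₀ N₀ r jz).coeff 1 =
    1 + MvPolynomial.C (π ^ (jz - N₀) * ι₀) * ρ₁ F w₀ π jz := by
  rw [Ftilde, coeff_add, coeff_add, coeff_C, if_neg one_ne_zero, coeff_C_mul, coeff_X_one, mul_one,
    zero_add, mul_assoc, coeff_C_mul, coeff_X_pow_mul', if_neg (by omega), mul_zero, add_zero]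

/-- **`C(c₀² π^r) · F̃ = F(π^j X, w₀ + c₀π^r W)`**, given `c₀ι₀ = π^{N₀}`, `F(0, w₀) = 0`,
`F_W(0, w₀) = c₀` and `j ≥ r + 2N₀`. [folklore] -/
theorem Ftilde_spec (hι : c₀ * ι₀ = π ^ N₀)
    (h0 : MvPolynomial.constantCoeff (F.eval (MvPolynomial.C w₀)) = 0)
    (h1 : MvPolynomial.constantCoeff ((derivative F).eval (MvPolynomial.C w₀)) = c₀)
    (hj : r + 2 * N₀ ≤ jz) :
    C (MvPolynomial.C (c₀ ^ 2 * π ^ r)) * Ftilde F w₀ π c₀ ι₀ N₀ r jz =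
      (zpoly (π ^ jz) F).comp
        (C (MvPolynomial.C w₀) + C (MvPolynomial.C (c₀ * π ^ r)) * X) := by
  rw [zpoly_comp, comp_C_mul_X_eq, ztaylor_coeff_zero, ztaylor_coeff_one, ρ₀_spec, ρ₁_spec,
    h0, h1, map_zero, zero_add, Ftilde]
  obtain ⟨d, rfl⟩ : ∃ d, jz = r + 2 * N₀ + d := ⟨jz - (r + 2 * N₀), by omega⟩
  have e1 : r + 2 * N₀ + d - r - 2 * N₀ = d := by omega
  have e2 : r + 2 * N₀ + d - N₀ = r + N₀ + d := by omega
  rw [e1, e2]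
  have hιS : (C (MvPolynomial.C c₀) : (MvPolynomial (Fin n) R)[X]) * C (MvPolynomial.C ι₀) =
      C (MvPolynomial.C π) ^ N₀ := by
    rw [← map_pow, ← map_pow, ← hι, map_mul, map_mul]
  simp only [map_add, map_mul, map_pow, map_one]
  set D := ((ztaylor (π ^ (r + 2 * N₀ + d)) F w₀).divX.divX).comp
    (C (MvPolynomial.C c₀ * MvPolynomial.C π ^ r) * X)
  linear_combination (C (MvPolynomial.C π) ^ (r + d) * C (ρ₀ F w₀ π (r + 2 * N₀ + d)) *
    (C (MvPolynomial.C c₀) * C (MvPolynomial.C ι₀) + C (MvPolynomial.C π) ^ N₀) +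
    C (MvPolynomial.C c₀) * C (MvPolynomial.C π) ^ (2 * r + N₀ + d) *
      C (ρ₁ F w₀ π (r + 2 * N₀ + d)) * X) * hιS

end Ftilde

/-! ### Honest polynomials for the built-in units: `Ž = Φ(π^j X, w₀ + c₀π^r W)·κ/π^b` -/

section Ztilde

variable (π c₀ : R) (r jz : ℕ) (κ z₀ : R) (b : ℕ)

/-- `σ₀` with `Φ(π^j X, w₀) = Φ(0, w₀) + π^j σ₀`. [folklore] -/
def σ₀ : MvPolynomial (Fin n) R :=
  (exists_zoomX_eq (π ^ jz) (F.eval (MvPolynomial.C w₀))).choose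

/-- Defining property of `σ₀`. [folklore] -/
theorem σ₀_spec : zoomX (π ^ jz) (F.eval (MvPolynomial.C w₀)) =
    MvPolynomial.C (MvPolynomial.constantCoeff (F.eval (MvPolynomial.C w₀))) +
      MvPolynomial.C (π ^ jz) * σ₀ F w₀ π jz :=
  (exists_zoomX_eq (π ^ jz) (F.eval (MvPolynomial.C w₀))).choose_spec

/-- `π^j · σ₀(0) = 0`. [folklore] -/
theorem pow_mul_constantCoeff_σ₀ :
    π ^ jz * MvPolynomial.constantCoeff (σ₀ F w₀ π jz) = 0 := by
  have h := congrArg MvPolynomial.constantCoeff (σ₀_spec F w₀ π jz)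
  rw [constantCoeff_zoomX, map_add, map_mul, MvPolynomial.constantCoeff_C,
    MvPolynomial.constantCoeff_C] at h
  exact (add_eq_left.mp h.symm)

/-- **`Ž = Φ(π^j X, w₀ + c₀π^r W)·κ/π^b = z₀ + π^{j−b} κ σ₀ + c₀ π^{r−b} κ · W · (…)`**, an
honest polynomial, given `Φ(0, w₀)·κ = π^b z₀`. [folklore] -/
def Ztilde : (MvPolynomial (Fin n) R)[X] :=
  C (MvPolynomial.C z₀ + MvPolynomial.C (π ^ (jz - b) * κ) * σ₀ F w₀ π jz) +
    C (MvPolynomial.C (c₀ * π ^ (r - b) * κ)) * X *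
      ((ztaylor (π ^ jz) F w₀).divX).comp (C (MvPolynomial.C (c₀ * π ^ r)) * X)

/-- `Ž₀ = z₀ + π^{j−b} κ σ₀`. [folklore] -/
theorem Ztilde_coeff_zero : (Ztilde F w₀ π c₀ r jz κ z₀ b).coeff 0 =
    MvPolynomial.C z₀ + MvPolynomial.C (π ^ (jz - b) * κ) * σ₀ F w₀ π jz := by
  rw [Ztilde, coeff_add, coeff_C_zero, mul_assoc, coeff_C_mul, coeff_X_mul_zero, mul_zero, add_zero]

/-- **`C(π^b) · Ž = C κ · Φ(π^j X, w₀ + c₀π^r W)`**, given `Φ(0, w₀)·κ = π^b z₀`, `j ≥ b`,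
`r ≥ b`. [folklore] -/
theorem Ztilde_spec (hz : MvPolynomial.constantCoeff (F.eval (MvPolynomial.C w₀)) * κ = π ^ b * z₀)
    (hj : b ≤ jz) (hr : b ≤ r) :
    C (MvPolynomial.C (π ^ b)) * Ztilde F w₀ π c₀ r jz κ z₀ b =
      C (MvPolynomial.C κ) * (zpoly (π ^ jz) F).comp
        (C (MvPolynomial.C w₀) + C (MvPolynomial.C (c₀ * π ^ r)) * X) := by
  rw [zpoly_comp, Ztilde]
  conv_rhs => rw [← X_mul_divX_add (ztaylor (π ^ jz) F w₀)]
  rw [ztaylor_coeff_zero, σ₀_spec]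
  obtain ⟨d, rfl⟩ : ∃ d, jz = b + d := ⟨jz - b, by omega⟩
  obtain ⟨d', rfl⟩ : ∃ d', r = b + d' := ⟨r - b, by omega⟩
  rw [Nat.add_sub_cancel_left, Nat.add_sub_cancel_left]
  have hzS : (C (MvPolynomial.C (MvPolynomial.constantCoeff (F.eval (MvPolynomial.C w₀)))) :
      (MvPolynomial (Fin n) R)[X]) * C (MvPolynomial.C κ) =
      C (MvPolynomial.C π) ^ b * C (MvPolynomial.C z₀) := by
    rw [← map_pow, ← map_pow, ← map_mul, ← map_mul, ← map_mul, ← map_mul, hz]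
  simp only [map_add, map_mul, map_pow, add_comp, mul_comp, X_comp, C_comp, pow_comp]
  linear_combination (-1 : (MvPolynomial (Fin n) R)[X]) * hzS

end Ztilde

end ZoomAlgebra

end Polydisc

end Literature.AlgebraicGeometry.Resolution
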